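import Mathlib.Analysis.Calculus.ContDiff.Convolution
import Mathlib.Analysis.Calculus.BumpFunction.Convolution
import Literature.Analysis.FluidPDE.HarmonicProbe
import HarnessLib

/-!
# Mollified distributionally harmonic functions on `ℝ³`

Analysis/FluidPDE support file (theorems only) for the `L³` pressure normalisation of classical
Navier–Stokes solutions (`PressureNormalisationL3.lean`; the `L³` twin of Tao 2011,
Lemma 4.1 (i), `NormalisedPressureDischarge.lean`). The harmonic part `h = p − Π[u]` of the
pressure is there only locally integrable (the Riesz pressure `Π[u(t)]` of an `L³` slice is an
`L^{3/2}` function), and harmonic only in the sense of distributions; Tao's probe argument is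
run on its mollifications `θ ⋆ h`, which are genuinely harmonic. This file supplies the
convolution calculus for that, on `ℝ³` with Lebesgue measure and Mathlib's convolution
`(f ⋆ g)(x) = ∫ f(t) g(x − t) dt` (`MeasureTheory.convolution` for `lsmul ℝ ℝ`):

* `fderiv_convolution_left_apply`, `laplacian_convolution_left` — for `f ∈ C¹_c` (resp. `C²_c`)
  and `g` locally integrable, `∂ₐ(f ⋆ g) = (∂ₐf) ⋆ g` and `Δ(f ⋆ g) = (Δf) ⋆ g` (Mathlib's
  `HasCompactSupport.hasFDerivAt_convolution_left`, iterated along an orthonormal basis);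
* `convolution_eq_zero_of_lt_norm`, `abs_convolution_le` — support and size of `f ⋆ g` for
  `f` supported in a ball and `g` nonnegative of unit mass;
* `harmonicOnNhd_convolution` — if `∫ g Δψ = 0` for all test functions `ψ`, then `θ ⋆ g` is
  harmonic on `ℝ³` for every test function `θ` (Weyl's lemma, mollified form);
* `convolution_assoc_of_hasCompactSupport` — `((k ⋆ θ) ⋆ g)(x) = (k ⋆ (θ ⋆ g))(x)` for
  `k, θ` continuous with compact support and `g` locally integrable (Mathlib
  `convolution_assoc`);
* `ae_eq_const_of_forall_convolution_normed_const` — if every mollification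
  `φ.normed ⋆ g` by a normed bump of outer radius `≤ 1` is a constant function, then `g` is
  a.e. constant
  (Lebesgue differentiation, Mathlib `ContDiffBump.ae_convolution_tendsto_right_of_locallyIntegrable`).

## Mathlib / tree search

Mathlib: `HasCompactSupport.hasFDerivAt_convolution_left`, `HasCompactSupport.contDiff_convolution_left`,
`HasCompactSupport.convolutionExists_left`, `convolution_assoc`, `convolution_lsmul`,
`ContinuousLinearMap.integral_apply`, `ContDiffBump.ae_convolution_tendsto_right_of_locallyIntegrable`,
`laplacian_eq_iteratedFDeriv_orthonormalBasis` (through the tree's `laplacian_eq_sum_fderiv_fderiv`).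
Tree: `laplacian_comp_const_sub`, `fderiv_comp_const_sub` (`HarmonicProbe.lean`),
`laplacian_eq_sum_fderiv_fderiv`, `continuous_laplacian` (`WholeSpaceIBP.lean`). No earlier
statement about Laplacians or harmonicity of Mathlib convolutions in the tree
(`lean search 'convolution'` in `Literature/Analysis/FluidPDE`: only the tree's own explicit
kernel integrals `∫ k(z) g(x − z) dz` with the derivative falling on the smooth factor `g`,
`HarmonicProbe.contDiff_integral_smul_comp_sub`).

## References

* H. Weyl, *The method of orthogonal projection in potential theory*, Duke Math. J. 7 (1940),
  Lemma 2 (harmonicity of weak solutions; mollified form).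
* T. Tao, *Localisation and compactness properties of the Navier–Stokes global regularity
  problem*, Anal. PDE 6 (2013) = arXiv:1108.1165, §4, proof of Lemma 4.1 (i).
-/

noncomputable section

open MeasureTheory Set Filter Metric Function ContinuousLinearMap
open scoped Topology Laplacian ContDiff Convolution InnerProductSpace

namespace Literature.Analysis.FluidPDE

namespace ConvolutionLaplacian

/-! ### Derivatives of `f ⋆ g` with the derivative on the compactly supported factor -/

/-- **`∂ₐ(f ⋆ g) = (∂ₐ f) ⋆ g`** for `f ∈ C¹_c(ℝ³)` and `g ∈ L¹_loc(ℝ³)` (Mathlib's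
`HasCompactSupport.hasFDerivAt_convolution_left`, evaluated in the direction `a`). [folklore] -/
theorem fderiv_convolution_left_apply {f g : (EuclideanSpace ℝ (Fin 3)) → ℝ} (hfc : HasCompactSupport f)
    (hf : ContDiff ℝ 1 f) (hg : LocallyIntegrable g volume) (x a : (EuclideanSpace ℝ (Fin 3))) :
    fderiv ℝ (f ⋆ g) x a = ((fun z => fderiv ℝ f z a) ⋆ g) x := by
  have h1 : HasCompactSupport (fderiv ℝ f) := hfc.fderiv (𝕜 := ℝ)
  have h2 : Continuous (fderiv ℝ f) := hf.continuous_fderiv one_ne_zero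
  have hint : ConvolutionExistsAt (fderiv ℝ f) g x
      (precompL (EuclideanSpace ℝ (Fin 3)) (lsmul ℝ ℝ : ℝ →L[ℝ] ℝ →L[ℝ] ℝ)) volume :=
    h1.convolutionExists_left (precompL (EuclideanSpace ℝ (Fin 3)) (lsmul ℝ ℝ : ℝ →L[ℝ] ℝ →L[ℝ] ℝ)) h2 hg x
  rw [(hfc.hasFDerivAt_convolution_left (lsmul ℝ ℝ : ℝ →L[ℝ] ℝ →L[ℝ] ℝ) hf hg x).fderiv,
    convolution_def, convolution_lsmul, ContinuousLinearMap.integral_apply hint.integrable a]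
  refine integral_congr_ae (Eventually.of_forall fun t => ?_)
  simp only [precompL_apply, lsmul_apply]

/-- `∂ₐ f ∈ C⁰_c` data: the directional derivative of a `Cⁿ⁺¹_c` function is `Cⁿ_c`. [folklore] -/
theorem contDiff_fderiv_apply {f : (EuclideanSpace ℝ (Fin 3)) → ℝ} {n : ℕ∞} (hf : ContDiff ℝ (n + 1) f) (a : (EuclideanSpace ℝ (Fin 3))) :
    ContDiff ℝ n fun z => fderiv ℝ f z a :=
  (hf.fderiv_right (m := n) le_rfl).clm_apply contDiff_const

/-- **`Δ(f ⋆ g) = (Δ f) ⋆ g`** for `f ∈ C²_c(ℝ³)` and `g ∈ L¹_loc(ℝ³)`: iterate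
`fderiv_convolution_left_apply` along an orthonormal basis and sum. [folklore] -/
theorem laplacian_convolution_left {f g : (EuclideanSpace ℝ (Fin 3)) → ℝ} (hfc : HasCompactSupport f)
    (hf : ContDiff ℝ 2 f) (hg : LocallyIntegrable g volume) (x : (EuclideanSpace ℝ (Fin 3))) :
    (Δ (f ⋆ g)) x = ((Δ f) ⋆ g) x := by
  set b := stdOrthonormalBasis ℝ (EuclideanSpace ℝ (Fin 3))
  have hf1 : ContDiff ℝ 1 f := hf.of_le one_le_two
  have h2 : ContDiff ℝ 2 (f ⋆ g) := hfc.contDiff_convolution_left (lsmul ℝ ℝ) hf hg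
  -- first derivatives
  have hD1 : ∀ e, (fun y => fderiv ℝ (f ⋆ g) y e) = (fun z => fderiv ℝ f z e) ⋆ g := fun e =>
    funext fun y => fderiv_convolution_left_apply hfc hf1 hg y e
  have hfe : ∀ e, ContDiff ℝ 1 fun z => fderiv ℝ f z e := fun e =>
    contDiff_fderiv_apply (n := 1) (by exact_mod_cast hf) e
  have hfec : ∀ e, HasCompactSupport fun z => fderiv ℝ f z e := fun e => hfc.fderiv_apply (𝕜 := ℝ) e
  -- second derivatives
  have hD2 : ∀ e, fderiv ℝ (fun y => fderiv ℝ (f ⋆ g) y e) x e =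
      ((fun z => fderiv ℝ (fun w => fderiv ℝ f w e) z e) ⋆ g) x := fun e => by
    rw [hD1 e, fderiv_convolution_left_apply (hfec e) (hfe e) hg x e]
  rw [FluidPDE.laplacian_eq_sum_fderiv_fderiv b h2 x]
  simp_rw [hD2]
  -- sum of convolutions = convolution of the sum
  have hint : ∀ i, Integrable (fun t => (fderiv ℝ (fun w => fderiv ℝ f w (b i)) t (b i)) • g (x - t))
      volume := fun i =>
    ((hfec (b i)).fderiv_apply (𝕜 := ℝ) (b i)).convolutionExists_left (lsmul ℝ ℝ)
      ((hfe (b i)).continuous_fderiv one_ne_zero |>.clm_apply continuous_const) hg x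
  simp only [convolution_lsmul]
  rw [← integral_finsetSum _ fun i _ => hint i]
  refine integral_congr_ae (Eventually.of_forall fun t => ?_)
  simp only
  rw [FluidPDE.laplacian_eq_sum_fderiv_fderiv b hf t, Finset.sum_smul]

/-! ### Support and size of `f ⋆ g` -/

/-- If `f` vanishes off `B̄(0, ρ₁)` and `g` vanishes off `B̄(0, ρ₂)`, then `(f ⋆ g)(x) = 0` for
`‖x‖ > ρ₁ + ρ₂`. [folklore] -/
theorem convolution_eq_zero_of_lt_norm {f g : (EuclideanSpace ℝ (Fin 3)) → ℝ} {ρ₁ ρ₂ : ℝ}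
    (hf : ∀ z, ρ₁ < ‖z‖ → f z = 0) (hg : ∀ z, ρ₂ < ‖z‖ → g z = 0) {x : (EuclideanSpace ℝ (Fin 3))}
    (hx : ρ₁ + ρ₂ < ‖x‖) : (f ⋆ g) x = 0 := by
  rw [convolution_lsmul]
  refine integral_eq_zero_of_ae (Eventually.of_forall fun t => ?_)
  simp only [Pi.zero_apply, smul_eq_mul]
  by_cases ht : ρ₁ < ‖t‖
  · rw [hf t ht, zero_mul]
  · push Not at ht
    have : ρ₂ < ‖x - t‖ := by
      have h1 : ‖x‖ ≤ ‖x - t‖ + ‖t‖ := norm_le_norm_sub_add x t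
      linarith
    rw [hg _ this, mul_zero]

/-- If `|f| ≤ C` and `g ≥ 0` has unit mass, then `|(f ⋆ g)(x)| ≤ C`. [folklore] -/
theorem abs_convolution_le {f g : (EuclideanSpace ℝ (Fin 3)) → ℝ} {C : ℝ}
    (hf : ∀ z, |f z| ≤ C) (hg0 : ∀ z, 0 ≤ g z) (hgi : Integrable g volume)
    (hg1 : ∫ z, g z = 1) (x : (EuclideanSpace ℝ (Fin 3))) : |(f ⋆ g) x| ≤ C := by
  rw [convolution_lsmul]
  have hC : 0 ≤ C := (abs_nonneg _).trans (hf 0)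
  have hgx : Integrable (fun t => g (x - t)) volume := hgi.comp_sub_left x
  have hle : ∀ t, |f t • g (x - t)| ≤ C * g (x - t) := fun t => by
    rw [smul_eq_mul, abs_mul, abs_of_nonneg (hg0 _)]
    exact mul_le_mul_of_nonneg_right (hf t) (hg0 _)
  calc |∫ t, f t • g (x - t)| ≤ ∫ t, C * g (x - t) := by
        rw [← Real.norm_eq_abs]
        refine norm_integral_le_of_norm_le (hgx.const_mul C) (Eventually.of_forall fun t => ?_)
        rw [Real.norm_eq_abs]; exact hle t
    _ = C := by rw [integral_const_mul, integral_sub_left_eq_self g volume x, hg1, mul_one]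

/-! ### Mollified distributionally harmonic functions are harmonic -/

/-- **Weyl's lemma, mollified form.** Let `g ∈ L¹_loc(ℝ³)` be harmonic in the sense of
distributions, `∫ g Δψ = 0` for every smooth compactly supported `ψ`, and let `θ` be smooth
with compact support. Then `θ ⋆ g` is (smooth and) harmonic on `ℝ³`:
`Δ(θ ⋆ g)(x) = ((Δθ) ⋆ g)(x) = ∫ g(z) Δ[θ(x − ·)](z) dz = 0`. [folklore] -/
theorem harmonicOnNhd_convolution {g θ : (EuclideanSpace ℝ (Fin 3)) → ℝ} (hg : LocallyIntegrable g volume)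
    (hharm : ∀ ψ : (EuclideanSpace ℝ (Fin 3)) → ℝ, ContDiff ℝ ∞ ψ → HasCompactSupport ψ → ∫ z, g z * (Δ ψ) z = 0)
    (hθ : ContDiff ℝ ∞ θ) (hθc : HasCompactSupport θ) :
    InnerProductSpace.HarmonicOnNhd (θ ⋆ g) univ := by
  have hsmooth : ContDiff ℝ ∞ (θ ⋆ g) := hθc.contDiff_convolution_left (lsmul ℝ ℝ) hθ hg
  have hθ2 : ContDiff ℝ 2 θ := contDiff_infty.1 hθ 2
  have hΔ : ∀ x, (Δ (θ ⋆ g)) x = 0 := fun x => by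
    rw [laplacian_convolution_left hθc hθ2 hg x, convolution_lsmul,
      ← integral_sub_left_eq_self _ volume x]
    simp only [sub_sub_cancel, smul_eq_mul]
    have hψ : ContDiff ℝ ∞ fun w => θ (x - w) := hθ.comp (contDiff_const.sub contDiff_id)
    have hψc : HasCompactSupport fun w => θ (x - w) := hθc.comp_homeomorph (Homeomorph.subLeft x)
    have h0 := hharm _ hψ hψc
    calc ∫ z, (Δ θ) (x - z) * g z = ∫ z, g z * (Δ (fun w => θ (x - w))) z := by
          refine integral_congr_ae (Eventually.of_forall fun z => ?_)
          show (Δ θ) (x - z) * g z = g z * (Δ (fun w => θ (x - w))) z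
          rw [laplacian_comp_const_sub, mul_comm]
      _ = 0 := h0
  have h2 : ContDiff ℝ 2 (θ ⋆ g) := contDiff_infty.1 hsmooth 2
  intro x _
  exact ⟨h2.contDiffAt, Eventually.of_forall hΔ⟩

/-! ### Associativity `(k ⋆ θ) ⋆ g = k ⋆ (θ ⋆ g)` -/

/-- **Associativity of convolution** for two continuous compactly supported factors and one
locally integrable factor: `((k ⋆ θ) ⋆ g)(x) = (k ⋆ (θ ⋆ g))(x)` (Mathlib `convolution_assoc`;
the integrability hypotheses hold because `k`, `θ` are bounded with compact support).
[folklore] -/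
theorem convolution_assoc_of_hasCompactSupport {k θ g : (EuclideanSpace ℝ (Fin 3)) → ℝ} (hk : Continuous k)
    (hkc : HasCompactSupport k) (hθ : Continuous θ) (hθc : HasCompactSupport θ)
    (hg : LocallyIntegrable g volume) (x : (EuclideanSpace ℝ (Fin 3))) :
    ((k ⋆ θ) ⋆ g) x = (k ⋆ (θ ⋆ g)) x := by
  have hgn : LocallyIntegrable (fun y => ‖g y‖) volume :=
    (locallyIntegrable_iff).2 fun K hK => ((locallyIntegrable_iff).1 hg K hK).norm
  refine convolution_assoc (lsmul ℝ ℝ) (lsmul ℝ ℝ) (lsmul ℝ ℝ) (lsmul ℝ ℝ)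
    (fun a b c => by simp only [lsmul_apply, smul_eq_mul, mul_assoc])
    hk.aestronglyMeasurable hθ.aestronglyMeasurable hg.aestronglyMeasurable
    (Eventually.of_forall fun y => hkc.convolutionExists_left _ hk hθ.locallyIntegrable y)
    (Eventually.of_forall fun y =>
      (hθc.norm.convolutionExists_left (mul ℝ ℝ) hθ.norm hgn) y) ?_
  -- `‖k‖ ⋆ (‖θ‖ ⋆ ‖g‖)` exists at `x`: `‖θ‖ ⋆ ‖g‖` is continuous
  have hc : Continuous ((fun y => ‖θ y‖) ⋆[mul ℝ ℝ, volume] fun y => ‖g y‖) :=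
    hθc.norm.continuous_convolution_left (mul ℝ ℝ) hθ.norm hgn
  exact hkc.norm.convolutionExists_left (mul ℝ ℝ) hk.norm hc.locallyIntegrable x

/-! ### A.e. constancy from constant mollifications -/

/-- The normed bumps of radii `(2(n+1))⁻¹ < (n+1)⁻¹` centred at the origin. [folklore] -/
theorem exists_contDiffBump_seq : ∃ φ : ℕ → ContDiffBump (0 : (EuclideanSpace ℝ (Fin 3))),
    (∀ n, (φ n).rOut = ((n : ℝ) + 1)⁻¹) ∧ ∀ n, (φ n).rOut ≤ 2 * (φ n).rIn := by
  refine ⟨fun n => ⟨(2 * ((n : ℝ) + 1))⁻¹, ((n : ℝ) + 1)⁻¹, by positivity, ?_⟩,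
    fun n => rfl, fun n => ?_⟩
  · have h1 : (0 : ℝ) < ((n : ℝ) + 1)⁻¹ := by positivity
    rw [mul_inv]
    exact mul_lt_of_lt_one_left h1 (by norm_num)
  · show ((n : ℝ) + 1)⁻¹ ≤ 2 * (2 * ((n : ℝ) + 1))⁻¹
    rw [mul_inv, ← mul_assoc, mul_inv_cancel₀ two_ne_zero, one_mul]

/-- **If every mollification of `g ∈ L¹_loc(ℝ³)` by a normed bump (of outer radius `≤ 1`) is a
constant function, then `g` is a.e. constant** (Lebesgue differentiation: `φₙ.normed ⋆ g → g` a.e. along bumps of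
shrinking radii, Mathlib `ContDiffBump.ae_convolution_tendsto_right_of_locallyIntegrable`).
[folklore] -/
theorem ae_eq_const_of_forall_convolution_normed_const {g : (EuclideanSpace ℝ (Fin 3)) → ℝ}
    (hg : LocallyIntegrable g volume)
    (hconst : ∀ φ : ContDiffBump (0 : (EuclideanSpace ℝ (Fin 3))), φ.rOut ≤ 1 → ∃ c : ℝ, ∀ x, (φ.normed volume ⋆ g) x = c) :
    ∃ C : ℝ, ∀ᵐ x ∂(volume : Measure (EuclideanSpace ℝ (Fin 3))), g x = C := by
  obtain ⟨φ, hφ, hφ2⟩ := exists_contDiffBump_seq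
  have hφ1 : ∀ n, (φ n).rOut ≤ 1 := fun n => by
    rw [hφ n]
    exact inv_le_one_of_one_le₀ (by simp)
  choose c hc using fun n => hconst (φ n) (hφ1 n)
  have hr : Tendsto (fun n => (φ n).rOut) atTop (𝓝 0) := by
    simp_rw [hφ]
    exact tendsto_inv_atTop_zero.comp
      (tendsto_atTop_add_const_right _ 1 tendsto_natCast_atTop_atTop)
  have hae := ContDiffBump.ae_convolution_tendsto_right_of_locallyIntegrable (μ := volume)
    (l := atTop) (K := 2) hr (Eventually.of_forall hφ2) hg
  -- on the full-measure set the constants `c n` converge to `g x`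
  have hae' : ∀ᵐ x ∂(volume : Measure (EuclideanSpace ℝ (Fin 3))), Tendsto c atTop (𝓝 (g x)) := by
    filter_upwards [hae] with x hx
    exact hx.congr fun n => hc n x
  -- pick one point of the set
  obtain ⟨x₁, hx₁⟩ : ∃ x₁, Tendsto c atTop (𝓝 (g x₁)) := by
    by_contra hne
    push Not at hne
    have : ∀ᵐ x ∂(volume : Measure (EuclideanSpace ℝ (Fin 3))), False := by
      filter_upwards [hae'] with x hx using hne x hx
    rw [ae_iff] at this
    simp only [not_false_eq_true, setOf_true, Measure.measure_univ_eq_zero] at this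
    exact (NeZero.ne (volume : Measure (EuclideanSpace ℝ (Fin 3)))) this
  refine ⟨g x₁, ?_⟩
  filter_upwards [hae'] with x hx
  exact tendsto_nhds_unique hx hx₁

end ConvolutionLaplacian

end Literature.Analysis.FluidPDE

end
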